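import Mathlib
import Summits.Ventures.PercRepro2.Defs
import Summits.Ventures.PercRepro2.Independence
import Summits.Ventures.PercRepro2.Harris
import Summits.Ventures.PercRepro2.Graph
import Summits.Ventures.PercRepro2.Exploration
import Summits.Ventures.PercRepro2.Events
import Summits.Ventures.PercRepro2.HCov
import Summits.Ventures.PercRepro2.HCovFns
import Summits.Ventures.PercRepro2.HCovSwap
import Summits.Ventures.PercRepro2.PendantRoot
import Summits.Ventures.PercRepro2.PendantO
import Summits.Ventures.PercRepro2.PendantB
import Summits.Ventures.PercRepro2.PendantBRow
import Summits.Ventures.PercRepro2.LeafStep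
import Summits.Ventures.PercRepro2.LeafStepT0
import Summits.Ventures.PercRepro2.LeafChain
import Summits.Ventures.PercRepro2.LeafEnds
import Summits.Ventures.PercRepro2.LeafPlus

import Summits.Ventures.PercRepro2.LeafDelete

/-!
# Pendant paths of any length (blind cell PercRepro2, p1 g8; continuation of `LeafDelete.lean`)

`PendantPath ends prev vs es x`: `vs = [v₀, …, v_k]` with edges `es = [e₀, …, e_k]`, `e_i = s(v_i, v_{i+1})`,
`v_{k+1} = x`, `v₀` a leaf and every later `v_i` of degree two, vertices distinct and avoiding `x`.
Deleting the outer leaf `v₀` (re-pointing `e₀` to a loop, `LeafDelete`) leaves a pendant path from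
`v₁` (`pendantPath_update_head`), so by induction on the list — transferring (HCOV) and the leaf
row across the deletion (`HCov_update_loop`, `LeafRow_update_loop`) and applying the one-step
theorems `HCov_of_leaf` / `leafRow_of_leaf` — **(HCOV) and the leaf row hold at every vertex of a
pendant path of any length attached at `x`, given both at `x`** (`HCov_pendantPath`); in particular
**(HCOV) at the end of every pendant path attached to a marked vertex `x ∈ {o, b, a₁, a₂}`**
(`HCov_pendantPath_marked`), the corrected, non-vacuous form of the landed path theorems.
-/

namespace Summit.Ventures.PercRepro2

open UnionCluster CovForm PendantRoot PendantO LeafStep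

namespace LeafDelete

/-! ## Pendant paths of any length -/

section PathList

variable {V : Type*} {E : Type*}

/-- **A pendant path** `vs = [v₀, …, v_k]` with edges `es = [e₀, …, e_k]` attached at `x`:
`e_i = s(v_i, v_{i+1})` with `v_{k+1} = x`, consecutive vertices distinct, `v_i ∉ {v_{i+1}, …, v_k, x}`,
`v₀` a leaf (its only edge is `e₀`) and every later `v_i` of degree two (edges `e_{i−1}`, `e_i`);
`prev` carries the previous edge. -/
def PendantPath (ends : E → Sym2 V) : Option E → List V → List E → V → Prop
  | _, [], [], _ => True
  | prev, v :: vs, e :: es, x =>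
      ends e = s(v, vs.headD x) ∧ v ≠ vs.headD x ∧ v ∉ vs ∧ v ≠ x ∧
        (∀ e', v ∈ ends e' → e' = e ∨ some e' = prev) ∧ PendantPath ends (some e) vs es x
  | _, _, _, _ => False

/-- Non-vacuity witness: the path `0 – 1 – 2` on `Fin 3` (edges `0 = s(0, 1)`, `1 = s(1, 2)`) is the
pendant path `[0, 1]` attached at `2`. -/
example : PendantPath (![s(0, 1), s(1, 2)] : Fin 2 → Sym2 (Fin 3)) none [0, 1] [0, 1] 2 := by
  simp only [PendantPath, List.headD_cons, List.headD_nil]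
  refine ⟨rfl, by decide, by decide, by decide, ?_, rfl, by decide, by decide, by decide, ?_, trivial⟩
  · intro e' he'
    fin_cases e' <;> simp_all
  · intro e' he'
    fin_cases e' <;> simp_all

variable [DecidableEq E]

/-- Re-pointing an edge `f ∋ a₃` with `a₃` off the path keeps the tail of the path. -/
lemma pendantPath_update_tail {ends : E → Sym2 V} {f : E} {a₃ x : V} (hf3 : a₃ ∈ ends f) :
    ∀ (vs : List V) (es : List E) (prev : E), PendantPath ends (some prev) vs es x →
      (∀ u ∈ vs, u ≠ a₃) → x ≠ a₃ →
      PendantPath (Function.update ends f s(a₃, a₃)) (some prev) vs es x := by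
  intro vs
  induction vs with
  | nil =>
    intro es prev h _ _
    cases es with
    | nil => trivial
    | cons e es => exact (h : False).elim
  | cons w ws ih =>
    intro es prev h hu hx
    cases es with
    | nil => exact (h : False).elim
    | cons e₁ es₁ =>
      obtain ⟨he, hne, hnin, hnx, hdeg, hrest⟩ := h
      have hw3 : w ≠ a₃ := hu w (by simp)
      have hnext3 : ws.headD x ≠ a₃ := by
        cases ws with
        | nil => exact hx
        | cons w' ws' => exact hu w' (by simp)
      have he1f : e₁ ≠ f := by
        rintro rfl
        rw [he, Sym2.mem_iff] at hf3
        rcases hf3 with h | h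
        · exact hw3 h.symm
        · exact hnext3 h.symm
      refine ⟨?_, hne, hnin, hnx, ?_, ?_⟩
      · rw [Function.update_of_ne he1f]; exact he
      · intro e' he'
        have hef : e' ≠ f := by
          rintro rfl
          rw [Function.update_self, Sym2.mem_iff] at he'
          rcases he' with h | h <;> exact hw3 h
        rw [Function.update_of_ne hef] at he'
        exact hdeg e' he'
      · exact ih es₁ e₁ hrest (fun u hu' => hu u (by simp [hu'])) hx

/-- Deleting the leaf `v₀` of a pendant path leaves a pendant path starting at `v₁`. -/
lemma pendantPath_update_head {ends : E → Sym2 V} {x v₀ : V} {e₀ : E} (vs : List V) (es : List E)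
    (h : PendantPath ends none (v₀ :: vs) (e₀ :: es) x) (hx : x ≠ v₀) :
    PendantPath (Function.update ends e₀ s(v₀, v₀)) none vs es x := by
  obtain ⟨he, hne, hnin, hnx, hdeg, hrest⟩ := h
  have hf3 : v₀ ∈ ends e₀ := by rw [he]; exact Sym2.mem_mk_left _ _
  cases vs with
  | nil =>
    cases es with
    | nil => trivial
    | cons e es => exact (hrest : False).elim
  | cons w ws =>
    cases es with
    | nil => exact (hrest : False).elim
    | cons e₁ es₁ =>
      obtain ⟨he1, hne1, hnin1, hnx1, hdeg1, hrest1⟩ := hrest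
      have hw0 : w ≠ v₀ := fun h => hnin (by simp [h])
      have hnext0 : ws.headD x ≠ v₀ := by
        cases ws with
        | nil => exact hx
        | cons w' ws' =>
          intro h
          simp only [List.headD_cons] at h
          exact hnin (by rw [← h]; simp)
      have he1f : e₁ ≠ e₀ := by
        rintro rfl
        rw [he1, Sym2.mem_iff] at hf3
        rcases hf3 with h | h
        · exact hw0 h.symm
        · exact hnext0 h.symm
      refine ⟨?_, hne1, hnin1, hnx1, ?_, ?_⟩
      · rw [Function.update_of_ne he1f]; exact he1
      · intro e' he'
        have hef : e' ≠ e₀ := by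
          rintro rfl
          rw [Function.update_self, Sym2.mem_iff] at he'
          rcases he' with h | h <;> exact hw0 h
        rw [Function.update_of_ne hef] at he'
        rcases hdeg1 e' he' with h | h
        · exact Or.inl h
        · exact absurd (Option.some.inj h) hef
      · exact pendantPath_update_tail hf3 ws es₁ e₁ hrest1
          (fun u hu h => hnin (by rw [← h]; simp [hu])) hx

end PathList

section PathTheorem

variable {V : Type*} {E : Type*} [Fintype E] [DecidableEq E] [Fintype V] [DecidableEq V]
  {R : Type*} [Field R] [LinearOrder R] [IsStrictOrderedRing R] (p : E → R)

/-- **(HCOV) with the leaf row along a pendant path of ANY length**: (HCOV) and the leaf row at the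
attachment vertex `x` give both at every vertex of a pendant path attached at `x` whose vertices
avoid the marks (the corrected, non-vacuous form of `LeafChain.HCov_pendant_path`). -/
theorem HCov_pendantPath (hp : IsProbVec p) {o a₁ a₂ b x : V} :
    ∀ (vs : List V) (es : List E) (ends : E → Sym2 V), PendantPath ends none vs es x →
      (∀ v ∈ vs, v ≠ o ∧ v ≠ b ∧ v ≠ a₁ ∧ v ≠ a₂) →
      HCov p ends o a₁ a₂ x b ∧ LeafRow p ends o a₁ a₂ x b →
      ∀ v ∈ vs, HCov p ends o a₁ a₂ v b ∧ LeafRow p ends o a₁ a₂ v b := by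
  intro vs
  induction vs with
  | nil => intro _ _ _ _ _ v hv; simp at hv
  | cons v vs ih =>
    intro es ends h hm hx u hu
    cases es with
    | nil => exact (h : False).elim
    | cons e es =>
      have h' := h
      obtain ⟨he, hne, hnin, hnx, hdeg, _⟩ := h'
      obtain ⟨hvo, hvb, hv1, hv2⟩ := hm v (by simp)
      have hleaf : ∀ e', v ∈ ends e' → e' = e := by
        intro e' he'
        rcases hdeg e' he' with h | h
        · exact h
        · exact absurd h (by simp)
      have hpath' := pendantPath_update_head vs es h hnx.symm
      have hx' : HCov p (Function.update ends e s(v, v)) o a₁ a₂ x b ∧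
          LeafRow p (Function.update ends e s(v, v)) o a₁ a₂ x b :=
        ⟨(HCov_update_loop p he hleaf hne (ne_comm.1 hvo) hv1.symm hv2.symm hnx.symm
            (ne_comm.1 hvb)).2 hx.1,
          (LeafRow_update_loop p he hleaf hne (ne_comm.1 hvo) hv1.symm hv2.symm hnx.symm
            (ne_comm.1 hvb)).2 hx.2⟩
      have hall' := ih es _ hpath' (fun u hu => hm u (by simp [hu])) hx'
      have hnext' : HCov p (Function.update ends e s(v, v)) o a₁ a₂ (vs.headD x) b ∧
          LeafRow p (Function.update ends e s(v, v)) o a₁ a₂ (vs.headD x) b := by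
        cases vs with
        | nil => exact hx'
        | cons w ws => exact hall' w (by simp)
      have hnext : HCov p ends o a₁ a₂ (vs.headD x) b ∧ LeafRow p ends o a₁ a₂ (vs.headD x) b :=
        ⟨(HCov_update_loop p he hleaf hne (ne_comm.1 hvo) hv1.symm hv2.symm hne.symm
            (ne_comm.1 hvb)).1 hnext'.1,
          (LeafRow_update_loop p he hleaf hne (ne_comm.1 hvo) hv1.symm hv2.symm hne.symm
            (ne_comm.1 hvb)).1 hnext'.2⟩
      have hv : HCov p ends o a₁ a₂ v b ∧ LeafRow p ends o a₁ a₂ v b :=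
        ⟨HCov_of_leaf p ends hp he hleaf hne hv1 hv2 hvo.symm hvb.symm hnext.1 hnext.2,
          leafRow_of_leaf p ends hp he hleaf hne hv1 hv2 hvo.symm hvb.symm hnext.2⟩
      rcases List.mem_cons.1 hu with rfl | hu'
      · exact hv
      · have hu3 : u ≠ v := fun h => hnin (h ▸ hu')
        obtain ⟨huo, hub, hu1, hu2⟩ := hm u (by simp [hu'])
        exact ⟨(HCov_update_loop p he hleaf hne (ne_comm.1 hvo) hv1.symm hv2.symm hu3
            (ne_comm.1 hvb)).1 (hall' u hu').1,
          (LeafRow_update_loop p he hleaf hne (ne_comm.1 hvo) hv1.symm hv2.symm hu3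
            (ne_comm.1 hvb)).1 (hall' u hu').2⟩


omit [Fintype V] [DecidableEq V] in
/-- `R½` is symmetric in the roots. -/
lemma Rhalf_root_swap (ends : E → Sym2 V) (o a₁ a₂ v b : V) :
    Rhalf p ends o a₂ a₁ v b = Rhalf p ends o a₁ a₂ v b := by
  unfold Rhalf T0 Gc1 mU mUU
  unfold EQbo EQb3 EQb3o EQo EQ3 EQ3o PDb PDbo Do gap
  rw [avoidAll_root_swap, PDEvent_root_swap]
  ring

omit [Fintype V] [DecidableEq V] in
/-- The leaf row is symmetric in the roots. -/
theorem leafRow_root_swap (ends : E → Sym2 V) (o a₁ a₂ v b : V) :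
    LeafRow p ends o a₂ a₁ v b ↔ LeafRow p ends o a₁ a₂ v b := by
  unfold LeafRow
  rw [Rhalf_root_swap]

/-- (HCOV) and the leaf row at every marked vertex `x ∈ {o, b, a₁, a₂}` (the degenerate markings). -/
theorem HCov_leafRow_marked (hp : IsProbVec p) (ends : E → Sym2 V) {o a₁ a₂ b x : V}
    (hx : x = o ∨ x = b ∨ x = a₁ ∨ x = a₂) :
    HCov p ends o a₁ a₂ x b ∧ LeafRow p ends o a₁ a₂ x b := by
  rcases hx with rfl | rfl | rfl | rfl
  · exact ⟨HCov_o p ends x a₁ a₂ b, leafRow_o p ends hp x a₁ a₂ b⟩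
  · exact ⟨HCov_b p ends hp o a₁ a₂ x, leafRow_b p ends hp o a₁ a₂ x⟩
  · exact ⟨(HCov_swap p ends o x a₂ x b).1 (HCov_root p ends o a₂ x b),
      (leafRow_root_swap p ends o x a₂ x b).1 (leafRow_root p ends hp o a₂ x b)⟩
  · exact ⟨HCov_root p ends o a₁ x b, leafRow_root p ends hp o a₁ x b⟩

/-- **(HCOV) at the end of a pendant path `a₃ – v – x` attached to a marked vertex `x ∈ {o, b, a₁, a₂}`**
(`v` of degree two; all weights) — the corrected `LeafEnds.HCov_pendant_path_{o,b,root}`. -/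
theorem HCov_pendant_path_marked (hp : IsProbVec p) (ends : E → Sym2 V) {f g : E} {a₃ v x : V}
    (hf : ends f = s(a₃, v)) (hleaf₃ : ∀ e, a₃ ∈ ends e → e = f) (h3v : a₃ ≠ v)
    (hg : ends g = s(v, x)) (hdeg : ∀ e, v ∈ ends e → e = g ∨ e = f) (hvx : v ≠ x) (h3x : a₃ ≠ x)
    {o a₁ a₂ b : V} (hx : x = o ∨ x = b ∨ x = a₁ ∨ x = a₂) (h31 : a₃ ≠ a₁) (h32 : a₃ ≠ a₂)
    (ho3 : o ≠ a₃) (hb3 : b ≠ a₃) (hv1 : v ≠ a₁) (hv2 : v ≠ a₂) (hov : o ≠ v) (hbv : b ≠ v) :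
    HCov p ends o a₁ a₂ a₃ b :=
  (HCov_pendant_path' p ends hp hf hleaf₃ h3v hg hdeg hvx h3x h31 h32 ho3 hb3 hv1 hv2 hov hbv
    (HCov_leafRow_marked p hp ends hx).1 (HCov_leafRow_marked p hp ends hx).2).1

/-- **(HCOV) at the end of a pendant path of any length attached to a marked vertex
`x ∈ {o, b, a₁, a₂}`** (all weights; the corrected `LeafEnds.HCov_pendant_path_{o,b,root}`). -/
theorem HCov_pendantPath_marked (hp : IsProbVec p) {o a₁ a₂ b x : V}
    (hx : x = o ∨ x = b ∨ x = a₁ ∨ x = a₂) (vs : List V) (es : List E) (ends : E → Sym2 V)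
    (h : PendantPath ends none vs es x) (hm : ∀ v ∈ vs, v ≠ o ∧ v ≠ b ∧ v ≠ a₁ ∧ v ≠ a₂) :
    ∀ v ∈ vs, HCov p ends o a₁ a₂ v b := by
  intro v hv
  exact (HCov_pendantPath p hp vs es ends h hm (HCov_leafRow_marked p hp ends hx) v hv).1

end PathTheorem


end LeafDelete

end Summit.Ventures.PercRepro2
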